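import Literature.Dynamics.Hyperbolic.CLPHyperbolicSetCalculus
import Mathlib.Analysis.Normed.Ring.Units

/-!
# Nearby splittings of a Chow–Lin–Palmer hyperbolic set: smallness of the cross projections and the unstable transfer map

Topic `Literature/Dynamics/Hyperbolic`.  For a Chow–Lin–Palmer hyperbolic structure
`IsCLPHyperbolicSet ψ T P Q N λ Δ` (Pilyugin1999 §1.3.4, file `ChowLinPalmerShadowing.lean`) and two points
`z, z' ∈ T` we compare the splittings `E = S(z) ⊕ U(z)` and `E = S(z') ⊕ U(z')` WITHOUT any continuity of
`x ↦ P(x)`: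

* `norm_Q_comp_P_le` — the CROSS PROJECTION `Q(z) ∘ P(z')` (the `U(z)`-component of stable vectors at
  `z'`) has norm `≤ Nλ^j (N(1+N)λ^j + Nω)` whenever `‖D(ψ^j)(z) - D(ψ^j)(z')‖ ≤ ω` (`j ≥ 1`): a stable
  vector at `z'` is contracted by `D(ψ^j)(z')`, hence almost contracted by `D(ψ^j)(z)`, so its unstable
  component at `z` is small by the backward bound (1.88).  Thus the STABLE spaces of a CLP set vary
  uniformly continuously in the weak sense `‖Q(z)P(z')‖ → 0`, a consequence of hyperbolicity and of the
  uniform continuity of `Dψ` alone (the unstable spaces need not: they are extra data);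
* `norm_le_of_mem_unstable_of_cross` — if both cross projections have norm `≤ η < 1`, then
  `Q(z') : U(z) → U(z')` is bounded below, `‖w‖ ≤ N/(1-η) ‖Q(z') w‖` on `U(z)`;
* `exists_mem_unstable_Q_eq` — and it is ONTO `U(z')`: `E = S(z') ⊕ U(z)` because
  `P(z')P(z) + Q(z) = 1 - Q(z')P(z)` is invertible (Neumann series in the Banach algebra `E →L[ℝ] E`).

These are the perturbation facts that make the linearisation of `ψ` along a PSEUDO-orbit `y` in `T`
(`z = ψ(y_k)`, `z' = y_{k+1}`, `‖z - z'‖ ≤ d`) a hyperbolic sequence with skew couplings (Pilyugin's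
(s2.1)–(s2.2) of the Steinlein–Walther proof, p. 47, there asserted from uniform continuity of the
projectors; here derived).  Everything is proved.  [folklore]
References: S. Yu. Pilyugin, *Shadowing in Dynamical Systems*, LNM 1706 (1999), §1.3.4 [Pilyugin1999].
-/

noncomputable section

open Set Function Metric
open scoped Topology

namespace Literature.Dynamics.Hyperbolic

variable {E : Type*} [NormedAddCommGroup E] [NormedSpace ℝ E]
variable {ψ : E → E} {T : Set E} {P Q : E → E →L[ℝ] E} {N lam Δ : ℝ}

/-! ## Smallness of the cross projection `Q(z) P(z')` -/

/-- **Cross projection bound (pointwise).**  For `z, z' ∈ T`, `j ≥ 1` and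
`‖D(ψ^j)(z) - D(ψ^j)(z')‖ ≤ ω`: `‖Q(z) P(z') v‖ ≤ Nλ^j (N(1+N)λ^j + Nω) ‖v‖`. [folklore] -/
theorem IsCLPHyperbolicSet.norm_Q_P_apply_le (h : IsCLPHyperbolicSet ψ T P Q N lam Δ) {z z' : E}
    (hz : z ∈ T) (hz' : z' ∈ T) {j : ℕ} (hj : 1 ≤ j) {ω : ℝ}
    (hω : ‖fderiv ℝ (ψ^[j]) z - fderiv ℝ (ψ^[j]) z'‖ ≤ ω) (v : E) :
    ‖Q z (P z' v)‖ ≤ N * lam ^ j * (N * (1 + N) * lam ^ j + N * ω) * ‖v‖ := by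
  have hN := h.N_pos.le
  have hlj : 0 ≤ lam ^ j := pow_nonneg h.lam_pos.le j
  set s' := P z' v with hs'
  set u := Q z s' with hu
  set D := fderiv ℝ (ψ^[j]) z with hD
  have hs'n : ‖s'‖ ≤ N * ‖v‖ :=
    (ContinuousLinearMap.le_opNorm _ _).trans (mul_le_mul_of_nonneg_right (h.norm_P_le z' hz') (norm_nonneg _))
  -- `D u = D s' - D (P z s')`
  have hsplit : D u = D s' - D (P z s') := by
    rw [eq_sub_iff_add_eq, ← map_add, add_comm, h.P_add_Q_apply hz s']
  have h1 : ‖D (P z s')‖ ≤ N * lam ^ j * (N * ‖v‖) :=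
    (h.norm_fderiv_iterate_P_le hz j s').trans (mul_le_mul_of_nonneg_left hs'n (mul_nonneg hN hlj))
  have h2 : ‖fderiv ℝ (ψ^[j]) z' s'‖ ≤ N * lam ^ j * ‖v‖ := h.norm_fderiv_iterate_P_le hz' j v
  have h3 : ‖D s' - fderiv ℝ (ψ^[j]) z' s'‖ ≤ ω * (N * ‖v‖) := by
    rw [show D s' - fderiv ℝ (ψ^[j]) z' s' = (D - fderiv ℝ (ψ^[j]) z') s' from rfl]
    exact (ContinuousLinearMap.le_opNorm _ _).trans (mul_le_mul hω hs'n (norm_nonneg _)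
      ((norm_nonneg _).trans hω))
  have hDu : ‖D u‖ ≤ (N * (1 + N) * lam ^ j + N * ω) * ‖v‖ := by
    rw [hsplit]
    calc ‖D s' - D (P z s')‖ ≤ ‖D s'‖ + ‖D (P z s')‖ := norm_sub_le _ _
      _ ≤ (‖D s' - fderiv ℝ (ψ^[j]) z' s'‖ + ‖fderiv ℝ (ψ^[j]) z' s'‖) + ‖D (P z s')‖ :=
          add_le_add (norm_le_norm_sub_add _ _) le_rfl
      _ ≤ (ω * (N * ‖v‖) + N * lam ^ j * ‖v‖) + N * lam ^ j * (N * ‖v‖) := by gcongr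
      _ = (N * (1 + N) * lam ^ j + N * ω) * ‖v‖ := by ring
  -- backward bound (1.88) at `z`: `u ∈ U(z)` is the preimage of `D u = Q(ψ^j z) (D u)`
  have humem : u ∈ range (Q z) := mem_range_self _
  have hDumem : D u ∈ range (Q (ψ^[j] z)) := (h.bijOn_unstable_iterate hz j).mapsTo humem
  have heq : D u = Q (ψ^[j] z) (D u) := (h.Q_apply_of_mem_Q (h.iterate_mem hz j) hDumem).symm
  calc ‖u‖ ≤ N * lam ^ j * ‖D u‖ := h.norm_le_of_fderiv_iterate_eq z hz j hj (D u) u humem heq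
    _ ≤ N * lam ^ j * ((N * (1 + N) * lam ^ j + N * ω) * ‖v‖) :=
        mul_le_mul_of_nonneg_left hDu (mul_nonneg hN hlj)
    _ = N * lam ^ j * (N * (1 + N) * lam ^ j + N * ω) * ‖v‖ := by ring

/-- **Cross projection bound (operator norm)**: `‖Q(z) ∘ P(z')‖ ≤ Nλ^j (N(1+N)λ^j + Nω)`. [folklore] -/
theorem IsCLPHyperbolicSet.norm_Q_comp_P_le (h : IsCLPHyperbolicSet ψ T P Q N lam Δ) {z z' : E}
    (hz : z ∈ T) (hz' : z' ∈ T) {j : ℕ} (hj : 1 ≤ j) {ω : ℝ} (hω0 : 0 ≤ ω)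
    (hω : ‖fderiv ℝ (ψ^[j]) z - fderiv ℝ (ψ^[j]) z'‖ ≤ ω) :
    ‖(Q z).comp (P z')‖ ≤ N * lam ^ j * (N * (1 + N) * lam ^ j + N * ω) := by
  have hN := h.N_pos.le
  have hlj : 0 ≤ lam ^ j := pow_nonneg h.lam_pos.le j
  refine ContinuousLinearMap.opNorm_le_bound _ (by positivity) fun v => ?_
  exact h.norm_Q_P_apply_le hz hz' hj hω v

/-! ## The unstable transfer `Q(z') : U(z) → U(z')` -/

/-- `Q(z') w = w - P(z') w`. [folklore] -/
theorem IsCLPHyperbolicSet.Q_apply_eq_sub (h : IsCLPHyperbolicSet ψ T P Q N lam Δ) {x : E} (hx : x ∈ T)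
    (w : E) : Q x w = w - P x w :=
  eq_sub_of_add_eq' (h.P_add_Q_apply hx w)

/-- **`Q(z')` is bounded below on `U(z)`**: if `‖Q(z) ∘ P(z')‖ ≤ η < 1` then
`‖w‖ ≤ N/(1-η) ‖Q(z') w‖` for `w ∈ U(z)`. [folklore] -/
theorem IsCLPHyperbolicSet.norm_le_of_mem_unstable_of_cross (h : IsCLPHyperbolicSet ψ T P Q N lam Δ)
    {z z' : E} (hz : z ∈ T) (hz' : z' ∈ T) {η : ℝ} (hη : ‖(Q z).comp (P z')‖ ≤ η) (hη1 : η < 1) {w : E}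
    (hw : w ∈ range (Q z)) : ‖w‖ ≤ N / (1 - η) * ‖Q z' w‖ := by
  have hN := h.N_pos.le
  -- `w = Q z (Q z' w) + (Q z ∘ P z') w`
  have hdec : w = Q z (Q z' w) + (Q z).comp (P z') w := by
    rw [ContinuousLinearMap.comp_apply, ← map_add, h.Q_apply_eq_sub hz', sub_add_cancel,
      h.Q_apply_of_mem_Q hz hw]
  have h1 : ‖Q z (Q z' w)‖ ≤ N * ‖Q z' w‖ :=
    (ContinuousLinearMap.le_opNorm _ _).trans (mul_le_mul_of_nonneg_right (h.norm_Q_le z hz) (norm_nonneg _))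
  have h2 : ‖(Q z).comp (P z') w‖ ≤ η * ‖w‖ :=
    (ContinuousLinearMap.le_opNorm _ _).trans (mul_le_mul_of_nonneg_right hη (norm_nonneg _))
  have h3 : ‖w‖ ≤ N * ‖Q z' w‖ + η * ‖w‖ := by
    calc ‖w‖ = ‖Q z (Q z' w) + (Q z).comp (P z') w‖ := by rw [← hdec]
      _ ≤ ‖Q z (Q z' w)‖ + ‖(Q z).comp (P z') w‖ := norm_add_le _ _
      _ ≤ N * ‖Q z' w‖ + η * ‖w‖ := add_le_add h1 h2
  have h1η : 0 < 1 - η := sub_pos.2 hη1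
  rw [div_mul_eq_mul_div, le_div_iff₀ h1η]
  nlinarith

variable [CompleteSpace E]

/-- **`Q(z')` maps `U(z)` ONTO `U(z')`** when `‖Q(z') ∘ P(z)‖ < 1`: every `u' ∈ U(z')` is `Q(z') w` for some
`w ∈ U(z)` (indeed `E = S(z') ⊕ U(z)`, as `1 - Q(z')P(z) = P(z')P(z) + Q(z)` is invertible by the Neumann
series). [folklore] -/
theorem IsCLPHyperbolicSet.exists_mem_unstable_Q_eq (h : IsCLPHyperbolicSet ψ T P Q N lam Δ) {z z' : E}
    (hz : z ∈ T) (hz' : z' ∈ T) (hlt : ‖(Q z').comp (P z)‖ < 1) {u' : E} (hu' : u' ∈ range (Q z')) :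
    ∃ w ∈ range (Q z), Q z' w = u' := by
  set t : E →L[ℝ] E := (Q z').comp (P z) with ht
  set Φ := Units.oneSub t hlt with hΦ
  set x : E := ((Φ⁻¹ : (E →L[ℝ] E)ˣ) : E →L[ℝ] E) u' with hx
  -- `(1 - t) x = u'`
  have hsolve : x - t x = u' := by
    have e1 : ((Φ : E →L[ℝ] E) * ((Φ⁻¹ : (E →L[ℝ] E)ˣ) : E →L[ℝ] E)) u' = u' := by
      rw [Units.mul_inv]; rfl
    rw [hΦ, Units.val_oneSub] at e1
    exact e1
  -- `u' = P z' (P z x) + Q z x`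
  have hdec : u' = P z' (P z x) + Q z x := by
    have e3 : u' = x - (P z x - P z' (P z x)) := by
      rw [← hsolve, ht, ContinuousLinearMap.comp_apply, h.Q_apply_eq_sub hz' (P z x)]
    calc u' = x - (P z x - P z' (P z x)) := e3
      _ = (P z x + Q z x) - (P z x - P z' (P z x)) := by rw [h.P_add_Q_apply hz x]
      _ = P z' (P z x) + Q z x := by abel
  refine ⟨Q z x, mem_range_self _, ?_⟩
  have e2 := congrArg (Q z') hdec
  rw [h.Q_apply_of_mem_Q hz' hu', map_add, h.Q_apply_of_mem_P hz' (mem_range_self _), zero_add] at e2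
  exact e2.symm

end Literature.Dynamics.Hyperbolic

end
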